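import Literature.MathematicalPhysics.QuantumFieldTheory.Balaban1983to89.Beta.OneStepKernelFamily
import Literature.MathematicalPhysics.QuantumFieldTheory.Balaban1983to89.Beta.ScalewiseWitness
import Literature.MathematicalPhysics.QuantumFieldTheory.Balaban1983to89.Beta.KernelReflection

/-!
# `BalabanUV.Beta.ColourNumeralJetScaling` — row D1 (an2): **THE COLOUR NUMERAL OF (D1) UNDER `(c, c²)` JET SCALING**

WHAT THIS FILE IS.  [folklore] bookkeeping, the kernel face of the row OWNER's RULING R-D1-g59-1 §2∕§4 (iv) (journal
`pub-balaban/CLAIMS.log` l.65933; memo `pub-balaban/b2b-balaban-beta-an2/gen59/R-D1-g59-1-NORMALISATION.md`): the one-loop step ∕ one-shot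
kernels `TbalOf`, `TshotOf` are `(1, 2)`-HOMOGENEOUS in the jet pair `(S, W)` (`hessKer = ½·tadpole(W) − ½·bubble(V, V)`, `V`
linear in `S`), and `stepBal (c·N) L = c²·stepBal N L`; hence for two step (resp. composite) jet families whose jets are related by
`S′ = c • S`, `W′ = c² • W` the predicates of `OneStepKernelFamily` transform as
`D1Drift Lc Js′ (c·N) μ ν ↔ D1Drift Lc Js N μ ν` and the scheme-free one-shot law
`(∃ U, ∀ m ≥ 1, |secondMoment (TshotOf Lc Jc′ m) μ ν − stepBal (c·N) Lc·m| ≤ U) ↔ (∃ U, ∀ m ≥ 1, |secondMoment (TshotOf Lc Jc m) μ ν − stepBal N Lc·m| ≤ U)`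
(each side is VERBATIM the clause of `Gaps.D1Residue.OneShotLaw`, so the equivalence reads `OneShotLaw Lc Jc′ (c·N) μ ν ↔ OneShotLaw Lc Jc N μ ν` by `Iff.rfl`; not imported).  Companion of `Gaps.D1Residue.d1Drift_colour_sq_unique` («(D1) for the same step
family with two numerals forces `Nc² = Nc'²`»): the numeral at which (D1) ∕ the one-shot law CAN hold for a given literal is fixed by the literal's
ABSOLUTE scale — a `(c, c²)`-rescaled copy of the same literal carries the numeral `c·N`.  For the row's literal of record
(`CombChartStepJets.JsB12CombSh0` with Wilson pair table `(8N²)⁻¹ • wsym22 N`) this is the typed form of the ruling's reading: whatever numeral `Nc` the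
hypothesis `hrep : D1Rep …` of the (III″) root is suppliable at, the `(2√2·N, 8N²)`-rescaled literal reads at `2√2·N·Nc` (provisional reading (β) of the
ruling: `Nc = (2√2)⁻¹`, i.e. the rescaled literal reads at `Nc = N`).  Nothing here decides that reading.

WHAT THIS FILE IS NOT.  No statement of Bałaban's papers is asserted, valued or discharged; no binder of row D1 (hW ∕ hR ∕ `D1Tel` ∕ `D1Rep`) is
touched; (D1) is NOT proved for any jets; NOT `BetaPertH`, NOT the continuum limit, NOT Clay.  HONEST DEPENDENCY (cell records, verbatim): «continuum YM
on T⁴ ⇐ BetaPertH ∧ nine spine estimates (0/9 proved); BetaPertH ⇐ (D1) ∧ (D4) ∧ CAP+tail; G-an2-4 gates asym, D1 and NE2/3/4.»  ABSOLUTE RULE (cell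
charter, verbatim): «No internally-minted statement may enter as a cited fact. Every hypothesis is either kernel-proved in this package or a verbatim
quotation of a PUBLISHED theorem with page reference.»  Every declaration below is kernel-proved from the imports; nothing is cited; no `def`, no
`def … : Prop`, 0 sorry.  Unit `b2b-balaban-beta-an2` (row D1 OWNER, gen 59), 2026-08-25.

§1 scalars: `stepBal_colour_mul`, `oneLoopDrift_const_mul`, `oneLoopDrift_const_mul_iff`.
§2 kernels: `hessKer_smul_jets_an2` (local twin of `D1BFx/PackedRoadJ2Scaling.hessKer_smul_jets`, not imported), `vertexOfK_const_smul`,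
   `TstepOf_smul_jets`, `TbalOf_smul_jets`, `TOf_smul_jets`, `TshotOf_smul_jets`.
§3 the dictionary: `d1Drift_smul_jets_iff`, `oneShotLaw_smul_jets_iff`.  Remark (nothing stated): the symmetry binders `hW`∕`hR` of row D1 are
   scale-invariant by `ScalewiseWitness.wardTransversal_smul` ∕ `axisReflectionCovariant_smul` (by name, not restated here).
-/

noncomputable section

open Finset
open scoped BigOperators
open Literature.MathematicalPhysics.QuantumFieldTheory
open Literature.MathematicalPhysics.QuantumFieldTheory.Balaban1983to89
open Literature.MathematicalPhysics.QuantumFieldTheory.Balaban1983to89.Beta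
open ExpKernelCalculus (MKer hessKer tadpole bubble)
open OneStepResolventKernel (JetData TOf vertexOf KInv)
open OneStepKernelFamily (vertexOfK TstepOf TbalOf TshotOf D1Drift KInvStep)
open B12Beta (secondMoment)
open Drift (OneLoopDrift)
open KernelReflection (tadpole_smul bubble_smul_left bubble_smul_right)
open ScalewiseWitness (secondMoment_smul)

namespace Summit.QuantumFields.BalabanUV.Beta.ColourNumeralJetScaling

/-! ## §1 Scalars: the slope and the drift predicate under scaling -/

/-- [folklore] `stepBal (c·N) L = c²·stepBal N L` — the lattice one-loop step is quadratic in the colour numeral. -/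
theorem stepBal_colour_mul (c N L : ℝ) : B12Normalization.stepBal (c * N) L = c ^ 2 * B12Normalization.stepBal N L := by
  rw [B12Normalization.stepBal_eq, B12Normalization.stepBal_eq]
  ring

/-- [folklore] A drift with slope `b` and width `A` becomes, after multiplying the sequence by `a`, a drift with slope `a·b` and width `|a|·A`. -/
theorem oneLoopDrift_const_mul (a : ℝ) {b A : ℝ} {β0 : ℕ → ℝ} (h : OneLoopDrift b A β0) :
    OneLoopDrift (a * b) (|a| * A) (fun j => a * β0 j) := by
  intro k
  have e : ∑ j ∈ range k, a * β0 j - a * b * k = a * (∑ j ∈ range k, β0 j - b * k) := by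
    rw [← mul_sum]; ring
  rw [e, abs_mul]
  exact mul_le_mul_of_nonneg_left (h k) (abs_nonneg a)

/-- [folklore] For `a ≠ 0` the drift predicate of the scaled sequence at the scaled slope is EQUIVALENT to the original one (widths existentially
quantified). -/
theorem oneLoopDrift_const_mul_iff {a : ℝ} (ha : a ≠ 0) (b : ℝ) (β0 : ℕ → ℝ) :
    (∃ A, OneLoopDrift (a * b) A (fun j => a * β0 j)) ↔ ∃ A, OneLoopDrift b A β0 := by
  constructor
  · rintro ⟨A, hA⟩
    refine ⟨|a⁻¹| * A, ?_⟩
    have h := oneLoopDrift_const_mul a⁻¹ hA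
    have hb : a⁻¹ * (a * b) = b := by field_simp
    have hβ : (fun j => a⁻¹ * (a * β0 j)) = β0 := funext fun j => by field_simp
    rwa [hb, hβ] at h
  · rintro ⟨A, hA⟩
    exact ⟨|a| * A, oneLoopDrift_const_mul a hA⟩

/-! ## §2 Kernels: `(1, 2)`-homogeneity of the resolvent Hessian kernels in the jets -/

variable {D : ℕ} {F : Type*} [Fintype F]

/-- [folklore] `hessKer A (c • V) (c² • W) = c² • hessKer A V W` (the tadpole is linear in `W`, the bubble bilinear in `V`). A local twin of
`D1BFx/PackedRoadJ2Scaling.hessKer_smul_jets` (road BF-x), kept here to avoid importing the road. -/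
theorem hessKer_smul_jets_an2 (c : ℝ) (A : MKer D F) (V : Fin D → (Fin D → ℤ) → MKer D F)
    (W : Fin D → (Fin D → ℤ) → Fin D → (Fin D → ℤ) → MKer D F) :
    hessKer A (fun μ y => c • V μ y) (fun μ y ν y' => (c ^ 2) • W μ y ν y') = (c ^ 2) • hessKer A V W := by
  funext μ ν z
  simp only [hessKer, Pi.smul_apply, smul_eq_mul]
  rw [tadpole_smul, bubble_smul_left, bubble_smul_right]
  ring

variable {d : ℕ}

/-- [folklore] The chain-rule vertex `vertexOfK K N S` is linear in the stencil family `S` (pointwise `tsum_mul_left`; unconditional). A local twin of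
`DecLiftAdjoint.vertexOfK_smul`, kept here to avoid importing the succession file. -/
theorem vertexOfK_const_smul (K : MKer (d + 1) (OneStepResolventKernel.Fib d)) (N : ℕ) (c : ℝ)
    (S : Fin (d + 1) → (Fin (d + 1) → ℤ) → MKer (d + 1) (OneStepResolventKernel.Fib d)) (μ : Fin (d + 1)) (y : Fin (d + 1) → ℤ) :
    vertexOfK K N (fun κ u => c • S κ u) μ y = c • vertexOfK K N S μ y := by
  funext x w a b
  simp only [vertexOfK, OneStepResolventKernel.wsum, Pi.smul_apply, smul_eq_mul]
  rw [Finset.mul_sum]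
  refine Finset.sum_congr rfl (fun κ' _ => ?_)
  rw [← tsum_mul_left]
  exact tsum_congr fun u => by ring

variable {Lc : ℕ} [NeZero Lc]

/-- [folklore] **THE STEP KERNEL IS `(1, 2)`-HOMOGENEOUS IN THE JETS**: if `J′.S = c • J.S` and `J′.W = c² • J.W` then `TstepOf Lc j J′ = c² • TstepOf Lc j J`. -/
theorem TstepOf_smul_jets (c : ℝ) (j : ℕ) (J J' : JetData d Lc) (hS : ∀ κ u, J'.S κ u = c • J.S κ u)
    (hW : ∀ μ y ν y', J'.W μ y ν y' = (c ^ 2) • J.W μ y ν y') : TstepOf Lc j J' = (c ^ 2) • TstepOf Lc j J := by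
  have hS' : J'.S = fun κ u => c • J.S κ u := funext fun κ => funext fun u => hS κ u
  have hW' : J'.W = fun μ y ν y' => (c ^ 2) • J.W μ y ν y' :=
    funext fun μ => funext fun y => funext fun ν => funext fun y' => hW μ y ν y'
  unfold TstepOf
  rw [hS', hW', vertexOfK_const_smul_family]
  · exact hessKer_smul_jets_an2 c _ _ _
where
  /-- the vertex family of the scaled stencil, as a function of the coarse bond -/
  vertexOfK_const_smul_family :
      vertexOfK (KInvStep (d := d) Lc j) Lc (fun κ u => c • J.S κ u) = fun μ y => c • vertexOfK (KInvStep (d := d) Lc j) Lc J.S μ y :=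
    funext fun μ => funext fun y => vertexOfK_const_smul _ _ c J.S μ y

/-- [folklore] **THE ONE-STEP FAMILY**: jets related by `(c, c²)` at every step ⟹ `TbalOf Lc Js′ j = c² • TbalOf Lc Js j`. -/
theorem TbalOf_smul_jets (c : ℝ) (Js Js' : ℕ → JetData 3 Lc) (hS : ∀ j κ u, (Js' j).S κ u = c • (Js j).S κ u)
    (hW : ∀ j μ y ν y', (Js' j).W μ y ν y' = (c ^ 2) • (Js j).W μ y ν y') (j : ℕ) :
    TbalOf Lc Js' j = (c ^ 2) • TbalOf Lc Js j :=
  TstepOf_smul_jets c j (Js j) (Js' j) (hS j) (hW j)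

/-- [folklore] **THE ONE-SHOT KERNEL OF A JET DATUM IS `(1, 2)`-HOMOGENEOUS**: `TOf J′ = c² • TOf J` for `J′.S = c • J.S`, `J′.W = c² • J.W`
(`vertexOf = vertexOfK KInv` by `OneStepKernelFamily.vertexOfK_KInv`). -/
theorem TOf_smul_jets {N : ℕ} [NeZero N] (c : ℝ) (J J' : JetData d N) (hS : ∀ κ u, J'.S κ u = c • J.S κ u)
    (hW : ∀ μ y ν y', J'.W μ y ν y' = (c ^ 2) • J.W μ y ν y') : TOf (N := N) J' = (c ^ 2) • TOf (N := N) J := by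
  have hS' : J'.S = fun κ u => c • J.S κ u := funext fun κ => funext fun u => hS κ u
  have hW' : J'.W = fun μ y ν y' => (c ^ 2) • J.W μ y ν y' :=
    funext fun μ => funext fun y => funext fun ν => funext fun y' => hW μ y ν y'
  have hV : vertexOf (N := N) (fun κ u => c • J.S κ u) = fun μ y => c • vertexOf (N := N) J.S μ y := by
    funext μ y
    rw [← OneStepKernelFamily.vertexOfK_KInv, ← OneStepKernelFamily.vertexOfK_KInv]
    exact vertexOfK_const_smul _ _ c J.S μ y
  unfold TOf
  rw [hS', hW', hV]
  exact hessKer_smul_jets_an2 c _ _ _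

/-- [folklore] **THE ONE-SHOT FAMILY**: composite jets related by `(c, c²)` at every scale ⟹ `TshotOf Lc Jc′ m = c² • TshotOf Lc Jc m`. -/
theorem TshotOf_smul_jets (c : ℝ) (Jc Jc' : ∀ m : ℕ, JetData 3 (Lc ^ m)) (hS : ∀ m κ u, (Jc' m).S κ u = c • (Jc m).S κ u)
    (hW : ∀ m μ y ν y', (Jc' m).W μ y ν y' = (c ^ 2) • (Jc m).W μ y ν y') (m : ℕ) :
    TshotOf Lc Jc' m = (c ^ 2) • TshotOf Lc Jc m :=
  TOf_smul_jets c (Jc m) (Jc' m) (hS m) (hW m)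

/-! ## §3 The dictionary: the colour numeral moves with the scale -/

/-- [folklore] **(D1) UNDER JET SCALING — THE NUMERAL MOVES BY `c`.**  For `c ≠ 0` and step jet families related by `S′ = c • S`, `W′ = c² • W`:
`D1Drift Lc Js′ (c·N) μ ν ↔ D1Drift Lc Js N μ ν`.  With `Gaps.D1Residue.d1Drift_colour_sq_unique` (not imported): the numeral of (D1) for a given
literal is determined by the literal's absolute scale, up to sign. -/
theorem d1Drift_smul_jets_iff {c : ℝ} (hc : c ≠ 0) (Js Js' : ℕ → JetData 3 Lc) (hS : ∀ j κ u, (Js' j).S κ u = c • (Js j).S κ u)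
    (hW : ∀ j μ y ν y', (Js' j).W μ y ν y' = (c ^ 2) • (Js j).W μ y ν y') (N : ℝ) (μ ν : Fin 4) :
    D1Drift Lc Js' (c * N) μ ν ↔ D1Drift Lc Js N μ ν := by
  have hβ : (fun j => secondMoment (TbalOf Lc Js' j) μ ν) = fun j => c ^ 2 * secondMoment (TbalOf Lc Js j) μ ν :=
    funext fun j => by rw [TbalOf_smul_jets c Js Js' hS hW j, secondMoment_smul]
  unfold D1Drift
  rw [hβ, stepBal_colour_mul]
  exact oneLoopDrift_const_mul_iff (pow_ne_zero 2 hc) _ _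

/-- [folklore] **THE SCHEME-FREE ONE-SHOT LAW UNDER JET SCALING** (each side is VERBATIM the clause of `Gaps.D1Residue.OneShotLaw` — operand order
`stepBal N Lc * m` as there — so this is `OneShotLaw Lc Jc′ (c·N) μ ν ↔ OneShotLaw Lc Jc N μ ν` by `Iff.rfl`; stated inline so that this file imports nothing of
the gaps cell): for `c ≠ 0` and composite jet families related by `S′ = c • S`, `W′ = c² • W`,
`(∃ U, ∀ m ≥ 1, |secondMoment (TshotOf Lc Jc′ m) μ ν − stepBal (c·N) Lc·m| ≤ U) ↔ (∃ U, ∀ m ≥ 1, |secondMoment (TshotOf Lc Jc m) μ ν − stepBal N Lc·m| ≤ U)`. -/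
theorem oneShotLaw_smul_jets_iff {c : ℝ} (hc : c ≠ 0) (Jc Jc' : ∀ m : ℕ, JetData 3 (Lc ^ m))
    (hS : ∀ m κ u, (Jc' m).S κ u = c • (Jc m).S κ u) (hW : ∀ m μ y ν y', (Jc' m).W μ y ν y' = (c ^ 2) • (Jc m).W μ y ν y')
    (N : ℝ) (μ ν : Fin 4) :
    (∃ U : ℝ, ∀ m : ℕ, 1 ≤ m → |secondMoment (TshotOf Lc Jc' m) μ ν - B12Normalization.stepBal (c * N) Lc * m| ≤ U) ↔
      ∃ U : ℝ, ∀ m : ℕ, 1 ≤ m → |secondMoment (TshotOf Lc Jc m) μ ν - B12Normalization.stepBal N Lc * m| ≤ U := by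
  have hm : ∀ m, secondMoment (TshotOf Lc Jc' m) μ ν = c ^ 2 * secondMoment (TshotOf Lc Jc m) μ ν :=
    fun m => by rw [TshotOf_smul_jets c Jc Jc' hS hW m, secondMoment_smul]
  have hc2 : 0 < |c ^ 2| := abs_pos.mpr (pow_ne_zero 2 hc)
  have key : ∀ m : ℕ, |secondMoment (TshotOf Lc Jc' m) μ ν - B12Normalization.stepBal (c * N) Lc * m|
      = |c ^ 2| * |secondMoment (TshotOf Lc Jc m) μ ν - B12Normalization.stepBal N Lc * m| := fun m => by
    rw [hm m, stepBal_colour_mul, ← abs_mul]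
    congr 1
    ring
  constructor
  · rintro ⟨U, hU⟩
    refine ⟨U / |c ^ 2|, fun m hm1 => ?_⟩
    rw [le_div_iff₀ hc2, mul_comm, ← key m]
    exact hU m hm1
  · rintro ⟨U, hU⟩
    refine ⟨|c ^ 2| * U, fun m hm1 => ?_⟩
    rw [key m]
    exact mul_le_mul_of_nonneg_left (hU m hm1) hc2.le

end Summit.QuantumFields.BalabanUV.Beta.ColourNumeralJetScaling

end
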